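import Summits.QuantumFields.YangMills.Theorems.BalabanUVNodesN15KingModelGraphPowerCountingRelabel

/-!
# BalabanUVNodes ∕ N15 — THE KING-MODEL RUNG (PART Γ-j): THE TRIANGLE — the hypothesis of part Γ-i's `king_prop36_graph_zeroField_R` («certificates with
# positive partial degrees along EVERY ordering, one elimination order per ordering») IS INHABITED BY A GRAPH WITH A LOOP: three `G`-lines in `d + 1 = 4`,
# King's degrees `D(H₁), D(H₂), D(H₃) = 2, 4, 2` along each of the six orderings, margin `γ₁ = 1`
# (Track A, DAG node N15 = NE2; FAN-OUT v1.1 §N15 s3 «KING-MODEL RUNG … NE2's analogue DECIDED in the model»)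

HONEST FRAMING.  Count-neutral (cell `pub-ymgap`, seat `pub-ymgap-dag-n15-e` g27; `--supports stmt-QuantumFields-27366 --as helper` = K3⁸
`SpineGivenEndpointR13SepCoPHV`).  TEMPLATE LITERATURE: C. King, *The U(1) Higgs model. I. The continuum limit*, Commun. Math. Phys. **102** (1986) 649–677
[King1986], proof of Proposition 3.6, pp. 663–664 ((3.66): the subgraphs `H_i` of an ordering and their degrees).  A NON-VACUITY WITNESS for the relabelled
certificates of part Γ-g and the margin hypothesis of parts Γ-h∕Γ-i on the simplest graph with a cycle: for the ordering with coarsest line `c` the two finer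
lines are Kruskal tree lines (the certificate `triCert c`, renumbering `1 ↔ 2` when the tree is the path `0–2–1`), the loop line `c` is bounded by its sup, and the
order list is `[−2, 2, 2]` (coarsest first) — partial degrees `2, 4, 2`, all `> 1`.  By contrast NO family of part Γ-a's fixed-numbering certificates serves all
orderings here (along `{1,2},{0,2},{0,1}` the vertex `1` is a leaf of the Kruskal tree `0–2–1` and must carry the larger number, along `{1,2},{0,1},{0,2}` the
vertex `2` must; with the other available forests the finest or the middle partial degree is `≤ 0`) — the reason part Γ-i is the form of record.  King's model
bookkeeping only; NOT Bałaban's `G(U)`; NOT a node discharge; nothing continuum ∕ ℝ⁴ ∕ OS ∕ mass-gap ∕ Clay.  0 `sorry`; standard axioms.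
THE PRINT.  p. 663 [PDF 15] (foot): *«H₁ = {the line l(1) and its two vertices}, H_{i+1} = H_i ∪ {the line l(i+1) and its two vertices}. (3.66)»*; p. 664 [PDF 16]:
*«Some of the subgraphs H_i may be divergent … renormalised graphs, in which every subgraph has positive degree»*.
WHAT THIS FILE PROVES (namespace `…N15KingModelRung.Curved`): `triSrc`∕`triTgt` (the triangle on `0, 1, 2`, lines `{0,1}, {0,2}, {1,2}`), `triCert c : ForestCertR 2 …`
(one per loop line; the structure fields by `decide`), `image_triCert_tl` (its tree lines = the other two), ★ `orderList_triangle` (along every ordering `π`, with the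
certificate of its coarsest line `π 2`: `orderList 4 (−2) π … = [−2, 2, 2]`), ★ **`triangle_margin_inhabited`** (`∃ cert, ∀ π, PosDegreesBy 1 (orderList (3+1)
(lineExp ∘ (fun _ => none)) π (cert π).F)` — literally the hypothesis shape of `king_prop36_graph_zeroField_R` at `d = 3`, `m = 3`, `nn = 2`, `κ ≡ none`).
HONEST SCOPE.  An example (degrees of the triangle with `G`-lines in four dimensions: `(d+1)(|V|−c) + Σ lineExp = 4·1 − 2, 4·2 − 4, 4·2 − 6`); nothing about the
graph VALUES is computed here; the impossibility remark for fixed numberings is prose (not typed).  Locators: [King1986] (3.66) p.663 (foot), p.664.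
-/
noncomputable section

namespace Summit.QuantumFields.YangMills.BalabanUVNodes.N15KingModelRung.Curved

open scoped BigOperators
open Finset
open Summit.QuantumFields.YangMills.BalabanUVNodes.N15KingModelRung.Graph

/-! ## The triangle: the hypothesis of `king_prop36_graph_zeroField_R` is inhabited by a graph with a loop -/

section Triangle

/-- the triangle's sources: lines `ℓ₀ = {0,1}`, `ℓ₁ = {0,2}`, `ℓ₂ = {1,2}` on the vertices `0, 1, 2` (external vertex `0`). [cite: King1986, (3.55)–(3.56) p.662] -/
def triSrc : Fin 3 → Fin 3 := ![0, 0, 1]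

/-- the triangle's targets. [cite: King1986, (3.55)–(3.56) p.662] -/
def triTgt : Fin 3 → Fin 3 := ![1, 2, 2]

/-- **THE TRIANGLE's CERTIFICATES, ONE PER LOOP LINE** `c` (the coarsest line of the ordering closes the loop; the two finer lines are Kruskal tree lines):
`c = ℓ₀`: tree `{ℓ₁, ℓ₂}` = path `0–2–1`, renumbering `1 ↔ 2`; `c = ℓ₁`: tree `{ℓ₀, ℓ₂}` = path `0–1–2`; `c = ℓ₂`: tree `{ℓ₀, ℓ₁}` = star at `0`.
[cite: King1986, (3.66) p.663, p.664 («Graphically, we have shrunk l(1) to a point in H»)] -/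
def triCert : Fin 3 → ForestCertR 2 triSrc triTgt
  | 0 => { ρ := Equiv.swap 1 2, ρ_zero := by decide,
           F := { tl := ![1, 2], tl_injective := by decide, lo := ![0, 1], lo_le := by decide, ends := by decide } }
  | 1 => { ρ := 1, ρ_zero := rfl,
           F := { tl := ![0, 2], tl_injective := by decide, lo := ![0, 1], lo_le := by decide, ends := by decide } }
  | 2 => { ρ := 1, ρ_zero := rfl,
           F := { tl := ![0, 1], tl_injective := by decide, lo := ![0, 0], lo_le := by decide, ends := by decide } }

/-- the tree lines of the certificate of the loop line `c` are the other two lines. [folklore] -/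
theorem image_triCert_tl (c : Fin 3) : (univ : Finset (Fin 2)).image (triCert c).F.tl = univ.erase c := by
  fin_cases c <;> decide

/-- along every ordering `π` (finest first) the certificate of its coarsest line `π 2` has the order list `[−2, 2, 2]` for three `G`-lines in `d + 1 = 4`
(`lineExp = 2 − 4 = −2` each; the two tree lines gain `dV = 4`): King's `D(H₁) = 2`, `D(H₂) = 4`, `D(H₃) = 2`. [cite: King1986, (3.66) p.663, p.664] -/
theorem orderList_triangle (π : Equiv.Perm (Fin 3)) :
    orderList (4 : ℝ) (fun _ : Fin 3 => (-2 : ℝ)) π (triCert (π 2)).F = [-2, 2, 2] := by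
  have hmem : ∀ p : Fin 3, (π p ∈ (univ : Finset (Fin 2)).image (triCert (π 2)).F.tl) ↔ p ≠ 2 := fun p => by
    rw [image_triCert_tl, mem_erase]
    simp only [mem_univ, and_true]
    exact π.injective.ne_iff
  have hall : (fun p : Fin 3 => orderExps (4 : ℝ) (fun _ : Fin 3 => (-2 : ℝ)) π (triCert (π 2)).F (Fin.rev p)) = ![-2, 2, 2] := by
    funext p
    fin_cases p
    · show orderExps (4 : ℝ) (fun _ : Fin 3 => (-2 : ℝ)) π (triCert (π 2)).F 2 = -2
      unfold orderExps; rw [if_neg (fun h => (hmem 2).1 h rfl)]; norm_num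
    · show orderExps (4 : ℝ) (fun _ : Fin 3 => (-2 : ℝ)) π (triCert (π 2)).F 1 = 2
      unfold orderExps; rw [if_pos ((hmem 1).2 (by decide))]; norm_num
    · show orderExps (4 : ℝ) (fun _ : Fin 3 => (-2 : ℝ)) π (triCert (π 2)).F 0 = 2
      unfold orderExps; rw [if_pos ((hmem 0).2 (by decide))]; norm_num
  unfold orderList
  rw [hall]
  simp [List.ofFn_succ]

/-- ★ **THE HYPOTHESIS OF `king_prop36_graph_zeroField_R` IS INHABITED BY A GRAPH WITH A LOOP**: the triangle with three `G`-lines in `d + 1 = 4` admits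
relabelled certificates along EVERY ordering whose order lists have partial degrees `2, 4, 2 > 1` — margin `γ₁ = 1` (while no family of certificates on
ONE numbering exists: along `{1,2},{0,2},{0,1}` the vertex `1` must be eliminated first, along `{1,2},{0,1},{0,2}` the vertex `2`).
[cite: King1986, (3.66) p.663, p.664 («in which every subgraph has positive degree»)] -/
theorem triangle_margin_inhabited :
    ∃ cert : Equiv.Perm (Fin 3) → ForestCertR 2 triSrc triTgt,
      ∀ π, PosDegreesBy 1 (orderList ((3 + 1 : ℕ) : ℝ) (fun ℓ : Fin 3 => lineExp (3 + 1) ((fun _ : Fin 3 => (none : Option (Fin (3 + 1)))) ℓ)) π (cert π).F) := by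
  refine ⟨fun π => triCert (π 2), fun π => ?_⟩
  have he : (fun ℓ : Fin 3 => lineExp (3 + 1) ((fun _ : Fin 3 => (none : Option (Fin (3 + 1)))) ℓ)) = fun _ => (-2 : ℝ) := by
    funext ℓ; simp only [lineExp_none]; push_cast; norm_num
  have h4 : ((3 + 1 : ℕ) : ℝ) = 4 := by norm_num
  rw [he, h4, orderList_triangle π]
  simp only [PosDegreesBy, List.sum_cons, List.sum_nil]
  norm_num

end Triangle

end Summit.QuantumFields.YangMills.BalabanUVNodes.N15KingModelRung.Curved

end
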